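import Summits.FinalStateConjecture.FinalStateConjecture.Theorems.ClusterCompletenessOmegaLimitMultiKerrBirthDefs
import Summits.FinalStateConjecture.FinalStateConjecture.Theorems.ClusterCompletenessOmegaLimitMultiKerrStubOrderUpgradeAssembly
import HarnessLib

/-!
# Route ClusterCompleteness · crux `OmegaLimitMultiKerr` — line BIRTH: the crux FROM its generic stub
# (the line's composition, importable)

The registered line `Lines/birth.lean` of the crux `ClusterCompleteness.OmegaLimitMultiKerr`
(stmt-FinalStateConjecture-17639) cut it into ONE generic stub — tame-generically, an MGHD exists and
every MGHD not settling in the T2 sense is tame-coarse-recurrent, `TameRecursO k` — and the pointwise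
ORDER UPGRADE `TameRecursO k 𝒟 → RecursO k 𝒟`, now the landed theorem `stub_orderUpgrade`
(`…StubOrderUpgradeAssembly.lean`, p147240, with `stub_landau` p145615, `stub_coneInterp` p145643,
`stub_holeCone` p145500). This file lands the line's COMPOSITION in the tree, so that the crux is
kernel-reduced to the one remaining statement (promoted to an item by the planners):

* `recursOGeneric_of_tameRecursOGeneric` — at each order `k` and manifold `X`, the generic stub's
  matrix implies the crux's matrix (monotonicity of tame genericity in the property, the same tame
  witness families serving; `stub_orderUpgrade` pointwise);
* `omegaLimitMultiKerr_of_tameRecursOGeneric` — hence the generic stub (for all `k`, `X`) implies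
  `OmegaLimitMultiKerr` (read back through `omegaLimitMultiKerr_iff`, `Iff.rfl`).

Together with `tameRecursOGeneric_of_finalStateConjecture` (the summit implies the generic stub) the
remaining statement is sandwiched: `FinalStateConjecture → stub 1 → OmegaLimitMultiKerr`.
References: Dafermos–Luk arXiv:1710.01722, §1.2.1; Christodoulou, CQG 16 (1999) A23.
-/

-- every `Summit.FinalStateConjecture.FinalStateConjecture.…` name repeats the summit = sub-problem segment (D-0017 layout)
set_option linter.dupNamespace false

noncomputable section

open scoped Manifold ContDiff Topology ENNReal
open Set Filter Function TopologicalSpace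

namespace Summit.FinalStateConjecture.FinalStateConjecture.Theorems.ClusterCompleteness

open Literature.Geometry.Lorentzian
open Summit.FinalStateConjecture.FinalStateConjecture.Theses.ClusterCompleteness (OmegaLimitMultiKerr)

/-- **The generic stub's matrix implies the crux's matrix, order by order.** If, tame-generically in
the admissible class of `X`, an MGHD exists and every MGHD not settling (T2) is `TameRecursO k`, then,
tame-generically, an MGHD exists and every MGHD not settling (T2) is `RecursO k`: the same tame
witness families serve (`isTameChristodoulouGeneric_mono_birth`) and the order upgrade
`stub_orderUpgrade` is pointwise. [folklore] -/
theorem recursOGeneric_of_tameRecursOGeneric (k : ℕ) (X : Type) [TopologicalSpace X]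
    [ChartedSpace E3 X] [IsManifold (𝓡 3) ∞ X] [T2Space X] [SecondCountableTopology X]
    [ConnectedSpace X]
    (h : InitialDataSet.IsTameChristodoulouGeneric (admissibleVacuumData X)
      (fun D ↦ (∃ 𝒟 : VacuumCauchyDevelopment D, 𝒟.IsMaximal) ∧
        ∀ 𝒟 : VacuumCauchyDevelopment D, 𝒟.IsMaximal → ¬ SettlesT2 𝒟 → TameRecursO k 𝒟) 1) :
    InitialDataSet.IsTameChristodoulouGeneric (admissibleVacuumData X)
      (fun D ↦ (∃ 𝒟 : VacuumCauchyDevelopment D, 𝒟.IsMaximal) ∧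
        ∀ 𝒟 : VacuumCauchyDevelopment D, 𝒟.IsMaximal → ¬ SettlesT2 𝒟 → RecursO k 𝒟) 1 :=
  isTameChristodoulouGeneric_mono_birth h fun D _ hP ↦
    ⟨hP.1, fun 𝒟 h𝒟 hS ↦ stub_orderUpgrade k X D 𝒟 (hP.2 𝒟 h𝒟 hS)⟩

/-- **The crux from its generic stub (the line's composition, kernel-checked and importable).**
The registered generic stub `stub_genericSettlesOrTameRecurs` of `Lines/birth.lean` — for every
order `k` and manifold `X`, tame-generically an MGHD exists and every non-settling (T2) MGHD is
`TameRecursO k` — implies `ClusterCompleteness.OmegaLimitMultiKerr`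
(`recursOGeneric_of_tameRecursOGeneric` at every `k`, read back through `omegaLimitMultiKerr_iff`).
With `tameRecursOGeneric_of_finalStateConjecture`: `FinalStateConjecture → stub 1 → crux`.
[folklore] -/
theorem omegaLimitMultiKerr_of_tameRecursOGeneric :
    (∀ (k : ℕ) (X : Type) [TopologicalSpace X] [ChartedSpace E3 X] [IsManifold (𝓡 3) ∞ X]
      [T2Space X] [SecondCountableTopology X] [ConnectedSpace X],
      InitialDataSet.IsTameChristodoulouGeneric (admissibleVacuumData X)
        (fun D ↦ (∃ 𝒟 : VacuumCauchyDevelopment D, 𝒟.IsMaximal) ∧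
          ∀ 𝒟 : VacuumCauchyDevelopment D, 𝒟.IsMaximal → ¬ SettlesT2 𝒟 → TameRecursO k 𝒟) 1) →
    OmegaLimitMultiKerr :=
  fun h ↦ omegaLimitMultiKerr_iff.mpr fun k X _ _ _ _ _ _ ↦
    recursOGeneric_of_tameRecursOGeneric k X (h k X)

end Summit.FinalStateConjecture.FinalStateConjecture.Theorems.ClusterCompleteness

end
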